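import Literature.Probability.RandomPlanarGeometry.HexSAWSurfaceWallRenewalEighthExact
import HarnessLib

/-!
# The ninth-order census identity of the adsorbed honeycomb walk:
# `y⁸ (β(y)² − y − 1/y − 1/y² − 2/y³ − 4/y⁴ − 6/y⁵ − 12/y⁶ − 18/y⁷) → N₁₀,₁ + N₁₁,₂ + N₁₂,₃ + N₁₃,₄ − 695`

`β(y) = wallRate y` is the exponential growth rate of wall bridges of self-avoiding walks on the brick-wall (hexagonal) lattice along a zigzag wall with
contact fugacity `y` («WALL-BRIDGES»); `N_{s,v} = #{ω ∈ ipwb (2s) : visits = v}` are the class numbers of the wall-renewal census.  The tree has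
`β(y)² = y + 1/y + 1/y² + 2/y³ + 4/y⁴ + 6/y⁵ + 12/y⁶ + 18/y⁷ + o(y⁻⁷)` with every coefficient EXACT («A7-EXACT» `HexSAWSurfaceWallRenewalEighthExact`,
on the COMPLETE diagonal `s − v = 8`: `N₉,₁ = 98`, `N₁₀,₂ = 99`, `N₁₁,₃ = 33`, `N₁₂,₄ = 1`).  This module is «EIGHTH-CENSUS-IDENTITY» ONE ORDER UP: the NINTH
coefficient EXISTS and is identified with the diagonal `s − v = 9` of the census, its four class numbers kept SYMBOLIC:

  ★★★ `tendsto_pow_eight_mul_wallRate_sq_sub_census (h₁ : m₁ = 20) (h₂ : m₂ = 22) (h₃ : m₃ = 24) (h₄ : m₄ = 26) :`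
      `y⁸ (β² − y − 1/y − 1/y² − 2/y³ − 4/y⁴ − 6/y⁵ − 12/y⁶ − 18/y⁷) → N₁₀,₁ + N₁₁,₂ + N₁₂,₃ + N₁₃,₄ − 695`

(`N₁₀,₁ = #((ipwb m₁).filter (visits m₁ · = 1))`, …; `eq_census_of_tendsto_…` the uniqueness form).  The kernel censuses `N₁₀,₁ = 267` («CENSUS-NINE-A»),
`N₁₁,₂ = 295`, `N₁₂,₃ = 132`, `N₁₃,₄ = 16` («CENSUS-NINE-B», by this seat's counting engine) turn it into `a₈ = 710 − 695 = 15` — a one-line corollary filed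
separately («A8-EXACT»); nothing here depends on them.

METHOD («EIGHTH-CENSUS-IDENTITY» with every index raised by one).  (§1) the seventh rung of the `β²`-tower, `L = y⁷(1 − r) − y⁵ − y⁴ − y³ − 2y² − 2y → 3`
(`r = y/β²`; from `a₆ = 12`, «A6-EXACT», by `L = D₆·r − H − P − 2Q − 4A − 6A/y`), and the fibre decompositions of the block polynomials
`Λ_n(y) = Σ_v N_{n,v} y^v` at `n = 22, 24, 26, 28` with the diagonal-`≤ 8` classes exact, the diagonal-9 classes symbolic and the rest crude (`#ipwb_n ≤ 3ⁿ`;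
`visits ≤ 4` by the six-step law, car 71).  (§2) Kesten's identity `Σ_s f_s = 1` on `y > μ³` («RENEWAL-CUBE-RANGE») at order NINE: the head
`H₉ = y/β² + y/β⁶ + y/β⁸ + 3y/β¹⁰ + (6y + y²)/β¹² + (15y + 3y²)/β¹⁴ + (38y + 11y²)/β¹⁶ + (98y + 34y² + y³)/β¹⁸ + (N₁₀,₁y + 99y² + 7y³)/β²⁰ + (N₁₁,₂y² + 33y³)/β²² +
(N₁₂,₃y³ + y⁴)/β²⁴ + N₁₃,₄y⁴/β²⁶` satisfies `1 − Aθ₃^{14} − CRUDE₉ ≤ H₉ ≤ 1`, tail at `n = 14` («KENDALL-CUBE»: `θ₃^{14} ≍ y^{−28/3} = o(y⁻⁹)`), `CRUDE₉ = 3²²y/β²² +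
3²⁴(y + y²)/β²⁴ + 3²⁶(y + y² + y³)/β²⁶ + 3²⁸(y + … + y⁴)/β²⁸ = O(y⁻¹⁰)`.  (§3) `y⁸β²(Aθ₃^{14} + CRUDE₉) → 0`.  (§4) the exact identity `T − G = y⁸β²(1 − H₉)` for
`T = y⁸(β² − y − … − 18/y⁷)` and the comparison function `G(y, r) = y⁷(r² − 1) + y⁶(r³ − 1) + y⁵(3r⁴ + r⁵ − 2) + y⁴(6r⁵ + 3r⁶ − 4) + y³(15r⁶ + 11r⁷ + r⁸ − 6) +
y²(38r⁷ + 34r⁸ + 7r⁹ − 12) + y(98r⁸ + 99r⁹ + 33r¹⁰ + r¹¹ − 18) + (N₁₀,₁r⁹ + N₁₁,₂r¹⁰ + N₁₂,₃r¹¹ + N₁₃,₄r¹²)` gives `G ≤ T ≤ G + y⁸β²·tail`.  (§5) `G → ΣN − 695`: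
the numeric part of `G` is an exact polynomial in the tower `A, Q, P, H, K, L` and `u = 1/y` (44 monomials, `ring`; orders one to seven exact: `A, Q, P → 1`, `H, K → 2`,
`L → 3`) tending to `−695`, and `N·r^s → N`.  (§6) squeeze.

HONEST LABEL.  LANE THEOREM for this model, DERIVED (assembly of the landed census chain through «A7-EXACT», the six-step law, the cube-range renewal toolkit
and the `β²`-tower); the printed sources carry `β ∼ √y` ([BeatonBousquetMelouDeGierDuminilCopinGuttmann2014, §3.1, Proposition 5 and p. 10 (arXiv v5)]) and the
renewal theory ([MadrasSlade1993, §4.2, (4.2.2), (4.2.4), Theorem 4.2.2 (pp. 91–92)], [Kesten1963SAW, §4]) only; the identity and the constant `695` are computed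
in this lane — NEW IN WRITING (modest), not quotations.  Budget lines: 1 (`set_option maxHeartbeats 400000 in` before
`ninth_order_two_sided_of_cube_lt`, whose closed-form identity `field_simp; ring` passes the default budget but not half of it).  Target arithmetic certified beforehand in exact rationals (`HOME/pub-sawmu-a-p6/g21/ninth/tower9.py`,
the `β²`-tower reduction of a-p6 g20: numeric part `→ −695`; with the diagonal-9 data `267 / 295 / 132 / 16` the limit is `15`, a-idea-1 g30–g34's fibre-programme
prediction `a₈ = 15`).  NOT CLAIMED: the values of the four class numbers, hence not `a₈ = 15` itself; any rate; anything for `y ≤ μ³`; the armchair wall.  No definitions.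
-/

noncomputable section

namespace Literature.Probability.RandomPlanarGeometry.SAW.HexBW.Wall

open Finset Filter Function
open Literature.Probability.LatticeModels
open _root_.Topology Asymptotics

variable {y : ℝ} {n : ℕ} {ω : ℕ → Site 2}

/-! ### §0  Private helpers -/

/-- [folklore] Relabel the limit of a `Tendsto` by an equal constant. -/
private theorem tendsto_of_tendsto_of_eq_ni {f : ℝ → ℝ} {L c : ℝ} (h : Tendsto f atTop (𝓝 L)) (e : L = c) :
    Tendsto f atTop (𝓝 c) := e ▸ h

/-- [folklore] `f₁(y) ≤ y/β(y)²` (`f₁ ≤ u₁ ≤ 1` would not do; the class `(1,1)` is the straight walk, so `Λ₂ ≤ y`: copied from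
«KESTEN-HEAD-SEVEN»'s private `pwbLaw_one_le_div_khs` via `IPWB ≤ PWB ≤ y` on `pwb 2 = {straight}`). [cite: MadrasSlade1993, §4.2, Theorem 4.2.2(b) (pp. 91–92)] -/
private theorem pwbLaw_one_le_div_ni (hy : 0 ≤ y) : pwbLaw y 1 ≤ y / wallRate y ^ 2 := by
  classical
  -- `pwb 2 ⊆ {straightWalk 2 2}` exactly as in «KESTEN-HEAD-SEVEN»
  have hsub : pwb 2 ⊆ {Zd.straightWalk 2 2} := by
    intro ω hω
    rw [Finset.mem_singleton]
    obtain ⟨hwbr, hbr⟩ := mem_pwb.1 hω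
    obtain ⟨harch, -⟩ := mem_wbr.1 hwbr
    obtain ⟨hhpw, -, h21⟩ := mem_archs.1 harch
    obtain ⟨hsaw, -⟩ := mem_hpw.1 hhpw
    obtain ⟨h0, hend, hbw, -⟩ := mem_saws_iff.1 hsaw
    have h00 : ω 0 0 = 0 := by simp [h0]
    have h01 : ω 0 1 = 0 := by simp [h0]
    have hs0 : brickWallGraph.Adj (ω 0) (ω 1) := hbw 0 (by norm_num)
    have hs1 : brickWallGraph.Adj (ω 1) (ω 2) := hbw 1 (by norm_num)
    rw [brickWallGraph_adj_coord] at hs0 hs1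
    have hb1 : ω 0 0 < ω 1 0 ∧ ω 1 0 ≤ ω 2 0 := hbr 1 le_rfl (by norm_num)
    have h10 : ω 1 0 = 1 := by omega
    have h11 : ω 1 1 = 0 := by omega
    have h20 : ω 2 0 = 2 := by omega
    funext i
    have hX : ω i 0 = ((min i 2 : ℕ) : ℤ) := by
      rcases Nat.lt_or_ge i 2 with hi | hi
      · interval_cases i
        · simp [h00]
        · simp [h10]
      · rw [hend i hi, min_eq_right hi, h20]; norm_num
    have hY : ω i 1 = 0 := by
      rcases Nat.lt_or_ge i 2 with hi | hi
      · interval_cases i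
        · exact h01
        · exact h11
      · rw [hend i hi, h21]
    funext j
    fin_cases j
    · simpa [straightWalk_apply_zero] using hX
    · simpa [straightWalk_apply_one] using hY
  have hv : visits 2 (Zd.straightWalk 2 2) = 1 := (straightWalk_mem_pwb 1).2
  have hP : PWB 2 y ≤ y := by
    unfold PWB
    calc ∑ ω ∈ pwb 2, y ^ visits 2 ω ≤ ∑ ω ∈ ({Zd.straightWalk 2 2} : Finset (ℕ → Site 2)), y ^ visits 2 ω :=
          Finset.sum_le_sum_of_subset_of_nonneg hsub (fun _ _ _ => pow_nonneg hy _)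
      _ = y := by rw [Finset.sum_singleton, hv, pow_one]
  show IPWB 2 y / wallRate y ^ 2 ≤ y / wallRate y ^ 2
  exact div_le_div_of_nonneg_right ((IPWB_le_PWB 2 hy).trans hP) (pow_pos (wallRate_pos y) 2).le

/-- [folklore] A class count is at most `3^n`: `#((ipwb n).filter p) ≤ 3^n`. [cite: MadrasSlade1993, §1.2, (1.2.16) (p. 11)] -/
private theorem card_filter_ipwb_le_ni (n : ℕ) (p : (ℕ → Site 2) → Prop) [DecidablePred p] :
    (#((ipwb n).filter p) : ℝ) ≤ 3 ^ n :=
  le_trans (by exact_mod_cast Finset.card_filter_le _ _) (card_ipwb_le_three_pow n)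

/-- [folklore] `f_k(y) = Λ_{2k}(y)/β(y)^{2k}` with the length as a numeral. [cite: MadrasSlade1993, §4.2, (4.2.2)] -/
private theorem pwbLaw_eq_ni (k : ℕ) {m : ℕ} (hm : m = 2 * k) : pwbLaw y k = IPWB m y / wallRate y ^ m := by
  rw [pwbLaw, hm]

/-- `y/β² → 1`. [cite: BeatonBousquetMelouDeGierDuminilCopinGuttmann2014, Section 3.1, Proposition 5 (arXiv v5 p. 9)] -/
private theorem tendsto_div_sq_wallRate_ni : Tendsto (fun y : ℝ => y / wallRate y ^ 2) atTop (𝓝 1) := by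
  have h1 : Tendsto (fun y : ℝ => ((wallRate y / Real.sqrt y) ^ 2)⁻¹) atTop (𝓝 ((1 : ℝ) ^ 2)⁻¹) :=
    (tendsto_wallRate_div_sqrt.pow 2).inv₀ (by norm_num)
  rw [one_pow, inv_one] at h1
  refine h1.congr' ?_
  filter_upwards [eventually_gt_atTop (0 : ℝ)] with y hy
  rw [div_pow, Real.sq_sqrt hy.le, inv_div]

/-- `β²/y → 1`. [cite: BeatonBousquetMelouDeGierDuminilCopinGuttmann2014, Section 3.1, Proposition 5 (arXiv v5 p. 9)] -/
private theorem tendsto_sq_wallRate_div_ni : Tendsto (fun y : ℝ => wallRate y ^ 2 / y) atTop (𝓝 1) := by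
  have h1 : Tendsto (fun y : ℝ => (wallRate y / Real.sqrt y) ^ 2) atTop (𝓝 ((1 : ℝ) ^ 2)) := tendsto_wallRate_div_sqrt.pow 2
  rw [one_pow] at h1
  refine h1.congr' ?_
  filter_upwards [eventually_gt_atTop (0 : ℝ)] with y hy
  rw [div_pow, Real.sq_sqrt hy.le]

/-- [folklore] Exponent bookkeeping: `(y^{2/3})^{14} = y⁹ · y^{1/3}` for `y > 0`. -/
private theorem rpow_two_thirds_pow_fourteen_ni (hy : 0 < y) : (y ^ ((2 : ℝ) / 3)) ^ 14 = y ^ 9 * y ^ ((1 : ℝ) / 3) := by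
  rw [← Real.rpow_natCast (y ^ ((2 : ℝ) / 3)) 14, ← Real.rpow_mul hy.le, ← Real.rpow_natCast y 9, ← Real.rpow_add hy]
  norm_num

/-! ### §1  The seventh rung of the `β²`-tower and the fibre decompositions of `Λ₂₂`, `Λ₂₄`, `Λ₂₆`, `Λ₂₈` -/

/-- ★ **`y⁷ (1 − y/β(y)²) − y⁵ − y⁴ − y³ − 2y² − 2y → 3`**, i.e. `1 − y/β² = 1/y² + 1/y³ + 1/y⁴ + 2/y⁵ + 2/y⁶ + 3/y⁷ + o(y⁻⁷)` — the seventh rung `L` of the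
`β²`-tower, from the seventh-order limit `y⁶(β² − y − 1/y − 1/y² − 2/y³ − 4/y⁴ − 6/y⁵) → 12` («A6-EXACT») by the identity `L = D₆·r − H − P − 2Q − 4A − 6A/y`
(`r = y/β²`, `A = y²(1 − r)`, `Q = y³(1 − r) − y`, `P = y⁴(1 − r) − y² − y`, `H = y⁵(1 − r) − y³ − y² − y`, `D₆ → 12`).
[cite: BeatonBousquetMelouDeGierDuminilCopinGuttmann2014, Section 3.1, Proposition 5 (arXiv v5 p. 9) and p. 10] -/
theorem tendsto_pow_seven_mul_one_sub_div_sub :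
    Tendsto (fun y : ℝ => y ^ 7 * (1 - y / wallRate y ^ 2) - y ^ 5 - y ^ 4 - y ^ 3 - 2 * y ^ 2 - 2 * y) atTop (𝓝 3) := by
  have hr := tendsto_div_wallRate_sq
  have hA := tendsto_sq_mul_one_sub_div_wallRate_sq
  have hQ := tendsto_cube_mul_one_sub_div_sub
  have hP := tendsto_pow_four_mul_one_sub_div_sub
  have hH := tendsto_pow_five_mul_one_sub_div_sub
  have hD := tendsto_pow_six_mul_wallRate_sq_sub
  have hu : Tendsto (fun y : ℝ => y⁻¹) atTop (𝓝 0) := tendsto_inv_atTop_zero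
  have h := (((((hD.mul hr).sub hH).sub hP).sub (hQ.const_mul 2)).sub (hA.const_mul 4)).sub ((hA.mul hu).const_mul 6)
  refine Tendsto.congr' ?_ (tendsto_of_tendsto_of_eq_ni h (by norm_num))
  filter_upwards [eventually_gt_atTop (0 : ℝ)] with y hy
  have hw : wallRate y ≠ 0 := (wallRate_pos y).ne'
  have hy' : y ≠ 0 := hy.ne'
  field_simp
  ring

open Classical in
/-- **Fibre decomposition of the block polynomial**: `Λ_m(y) = Σ_{v ≤ V} N_{m,v}·y^v` for any bound `V` on the surface visits of the blocks of length `m`.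
[cite: MadrasSlade1993, Section 4.2, (4.2.2) (p. 91)] [cite: BeatonBousquetMelouDeGierDuminilCopinGuttmann2014, Section 3.1 (arXiv v5 p. 8)] -/
theorem IPWB_eq_sum_range_card_mul_pow {m V : ℕ} (hV : ∀ ω ∈ ipwb m, visits m ω ≤ V) (y : ℝ) :
    IPWB m y = ∑ v ∈ Finset.range (V + 1), (#((ipwb m).filter fun ω => visits m ω = v) : ℝ) * y ^ v := by
  rw [IPWB, ← Finset.sum_fiberwise_of_maps_to (s := ipwb m) (t := Finset.range (V + 1)) (g := fun ω => visits m ω)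
    (fun ω hω => Finset.mem_range.2 (Nat.lt_succ_of_le (hV ω hω)))]
  refine Finset.sum_congr rfl fun v _ => ?_
  rw [Finset.sum_congr rfl fun ω hω => by rw [(Finset.mem_filter.1 hω).2], Finset.sum_const, nsmul_eq_mul]

open Classical in
/-- No block has zero surface visits (its last step is a visit). [cite: MadrasSlade1993, Section 4.2, Definition 4.2.1] [cite: BeatonBousquetMelouDeGierDuminilCopinGuttmann2014, Section 3.1 (arXiv v5 p. 8)] -/
theorem card_zeroVisit_ipwb_eq_zero (m : ℕ) : #((ipwb m).filter fun ω => visits m ω = 0) = 0 :=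
  Finset.card_eq_zero.2 (Finset.filter_eq_empty_iff.2 fun ω hω h0 => by have := one_le_visits_of_mem_ipwb hω; omega)

/-- Blocks of length `n ∈ [22, 29]` visit the surface at most four times (six-step law `6·visits ≤ n`, car 71). [cite: MadrasSlade1993, Section 4.2, remark before (4.2.21) (p. 94)] -/
theorem visits_le_four_of_le_twentynine (h22 : 4 ≤ n) (h29 : n ≤ 29) (hω : ω ∈ ipwb n) : visits n ω ≤ 4 := by
  have := six_mul_visits_le hω h22
  omega

open Classical in
/-- ★ `Λ₂₂(y) = N₁₁,₁·y + N₁₁,₂·y² + 33y³` with `N₁₁,₁ ≤ 3²²` (`N₁₁,₃ = 33`, «CENSUS-EIGHT-B2»); hence for `y ≥ 0`: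
`N₁₁,₂y² + 33y³ ≤ Λ₂₂(y) ≤ 3²²y + N₁₁,₂y² + 33y³`. [cite: MadrasSlade1993, Section 4.2, (4.2.2); Section 1.2, (1.2.16) (p. 11)] -/
theorem IPWB_twentytwo_two_sided {m : ℕ} (hm : m = 22) (hy : 0 ≤ y) :
    #((ipwb m).filter fun ω => visits m ω = 2) * y ^ 2 + 33 * y ^ 3 ≤ IPWB m y ∧
      IPWB m y ≤ 3 ^ 22 * y + #((ipwb m).filter fun ω => visits m ω = 2) * y ^ 2 + 33 * y ^ 3 := by
  have e := IPWB_eq_sum_range_card_mul_pow (m := m) (V := 4) (fun ω hω => visits_le_four_of_le_twentynine (by omega) (by omega) hω) y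
  have h4 : #((ipwb m).filter fun ω => visits m ω = 4) = 0 :=
    Finset.card_eq_zero.2 (Finset.filter_eq_empty_iff.2 fun ω hω h4 => by have := six_mul_visits_le hω (by omega); omega)
  simp only [Finset.sum_range_succ, Finset.sum_range_zero, card_zeroVisit_ipwb_eq_zero, card_threeVisit_ipwb_twentytwo_eq_thirtyThree hm, h4] at e
  have h3 : (3 : ℝ) ^ m = 3 ^ 22 := by rw [hm]
  have hN1 := mul_le_mul_of_nonneg_right (card_filter_ipwb_le_ni m (fun ω => visits m ω = 1)) hy
  have hN1' : (0 : ℝ) ≤ #((ipwb m).filter fun ω => visits m ω = 1) * y := mul_nonneg (Nat.cast_nonneg _) hy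
  rw [h3] at hN1
  constructor
  · rw [e]; push_cast; linarith [hN1']
  · rw [e]; push_cast; linarith [hN1]

open Classical in
/-- ★ `Λ₂₄(y) = N₁₂,₁·y + N₁₂,₂·y² + N₁₂,₃·y³ + y⁴` with `N₁₂,₁, N₁₂,₂ ≤ 3²⁴` (`N₁₂,₄ = 1`, «SIX-STEP-RIGIDITY» via «A7-EXACT»); hence for `y ≥ 0`:
`N₁₂,₃y³ + y⁴ ≤ Λ₂₄(y) ≤ 3²⁴(y + y²) + N₁₂,₃y³ + y⁴`. [cite: MadrasSlade1993, Section 4.2, (4.2.2); Section 1.2, (1.2.16) (p. 11)] -/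
theorem IPWB_twentyfour_two_sided {m : ℕ} (hm : m = 24) (hy : 0 ≤ y) :
    #((ipwb m).filter fun ω => visits m ω = 3) * y ^ 3 + y ^ 4 ≤ IPWB m y ∧
      IPWB m y ≤ 3 ^ 24 * (y + y ^ 2) + #((ipwb m).filter fun ω => visits m ω = 3) * y ^ 3 + y ^ 4 := by
  have e := IPWB_eq_sum_range_card_mul_pow (m := m) (V := 4) (fun ω hω => visits_le_four_of_le_twentynine (by omega) (by omega) hω) y
  simp only [Finset.sum_range_succ, Finset.sum_range_zero, card_zeroVisit_ipwb_eq_zero, card_fourVisit_ipwb_twentyfour_eq_one hm] at e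
  have h3 : (3 : ℝ) ^ m = 3 ^ 24 := by rw [hm]
  have hN1 := mul_le_mul_of_nonneg_right (card_filter_ipwb_le_ni m (fun ω => visits m ω = 1)) hy
  have hN2 := mul_le_mul_of_nonneg_right (card_filter_ipwb_le_ni m (fun ω => visits m ω = 2)) (pow_nonneg hy 2)
  have hN1' : (0 : ℝ) ≤ #((ipwb m).filter fun ω => visits m ω = 1) * y := mul_nonneg (Nat.cast_nonneg _) hy
  have hN2' : (0 : ℝ) ≤ #((ipwb m).filter fun ω => visits m ω = 2) * y ^ 2 := mul_nonneg (Nat.cast_nonneg _) (pow_nonneg hy 2)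
  rw [h3] at hN1 hN2
  constructor
  · rw [e]; push_cast; linarith [hN1', hN2']
  · rw [e]; push_cast; linarith [hN1, hN2]

open Classical in
/-- ★ `Λ₂₆(y) = N₁₃,₁·y + N₁₃,₂·y² + N₁₃,₃·y³ + N₁₃,₄·y⁴` with `N₁₃,₁, N₁₃,₂, N₁₃,₃ ≤ 3²⁶`; hence for `y ≥ 0`:
`N₁₃,₄y⁴ ≤ Λ₂₆(y) ≤ 3²⁶(y + y² + y³) + N₁₃,₄y⁴`. [cite: MadrasSlade1993, Section 4.2, (4.2.2); Section 1.2, (1.2.16) (p. 11)] -/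
theorem IPWB_twentysix_two_sided {m : ℕ} (hm : m = 26) (hy : 0 ≤ y) :
    #((ipwb m).filter fun ω => visits m ω = 4) * y ^ 4 ≤ IPWB m y ∧
      IPWB m y ≤ 3 ^ 26 * (y + y ^ 2 + y ^ 3) + #((ipwb m).filter fun ω => visits m ω = 4) * y ^ 4 := by
  have e := IPWB_eq_sum_range_card_mul_pow (m := m) (V := 4) (fun ω hω => visits_le_four_of_le_twentynine (by omega) (by omega) hω) y
  simp only [Finset.sum_range_succ, Finset.sum_range_zero, card_zeroVisit_ipwb_eq_zero] at e
  have h3 : (3 : ℝ) ^ m = 3 ^ 26 := by rw [hm]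
  have hN1 := mul_le_mul_of_nonneg_right (card_filter_ipwb_le_ni m (fun ω => visits m ω = 1)) hy
  have hN2 := mul_le_mul_of_nonneg_right (card_filter_ipwb_le_ni m (fun ω => visits m ω = 2)) (pow_nonneg hy 2)
  have hN3 := mul_le_mul_of_nonneg_right (card_filter_ipwb_le_ni m (fun ω => visits m ω = 3)) (pow_nonneg hy 3)
  have hN1' : (0 : ℝ) ≤ #((ipwb m).filter fun ω => visits m ω = 1) * y := mul_nonneg (Nat.cast_nonneg _) hy
  have hN2' : (0 : ℝ) ≤ #((ipwb m).filter fun ω => visits m ω = 2) * y ^ 2 := mul_nonneg (Nat.cast_nonneg _) (pow_nonneg hy 2)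
  have hN3' : (0 : ℝ) ≤ #((ipwb m).filter fun ω => visits m ω = 3) * y ^ 3 := mul_nonneg (Nat.cast_nonneg _) (pow_nonneg hy 3)
  rw [h3] at hN1 hN2 hN3
  constructor
  · rw [e]; push_cast; linarith [hN1', hN2', hN3']
  · rw [e]; push_cast; linarith [hN1, hN2, hN3]

/-- ★ `Λ₂₈(y) ≤ 3²⁸(y + y² + y³ + y⁴)` for `y ≥ 0` (`1 ≤ visits ≤ 4` on `ipwb 28`). [cite: MadrasSlade1993, Section 4.2, (4.2.2); Section 1.2, (1.2.16) (p. 11)] -/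
theorem IPWB_twentyeight_le {m : ℕ} (hm : m = 28) (hy : 0 ≤ y) : IPWB m y ≤ 3 ^ 28 * (y + y ^ 2 + y ^ 3 + y ^ 4) := by
  classical
  have hterm : ∀ ω ∈ ipwb m, y ^ visits m ω ≤ y + y ^ 2 + y ^ 3 + y ^ 4 := by
    intro ω hω
    have h1 := one_le_visits_of_mem_ipwb hω
    have h4 : visits m ω ≤ 4 := visits_le_four_of_le_twentynine (by omega) (by omega) hω
    have hy2 : 0 ≤ y ^ 2 := pow_nonneg hy 2
    have hy3 : 0 ≤ y ^ 3 := pow_nonneg hy 3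
    have hy4 : 0 ≤ y ^ 4 := pow_nonneg hy 4
    rcases Nat.lt_or_ge (visits m ω) 2 with hv | hv
    · rw [show visits m ω = 1 by omega, pow_one]; linarith
    rcases Nat.lt_or_ge (visits m ω) 3 with hv' | hv'
    · rw [show visits m ω = 2 by omega]; linarith
    rcases Nat.lt_or_ge (visits m ω) 4 with hv'' | hv''
    · rw [show visits m ω = 3 by omega]; linarith
    · rw [show visits m ω = 4 by omega]; linarith
  calc IPWB m y = ∑ ω ∈ ipwb m, y ^ visits m ω := rfl
    _ ≤ ∑ _ω ∈ ipwb m, (y + y ^ 2 + y ^ 3 + y ^ 4) := Finset.sum_le_sum hterm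
    _ = #(ipwb m) * (y + y ^ 2 + y ^ 3 + y ^ 4) := by rw [Finset.sum_const, nsmul_eq_mul]
    _ ≤ 3 ^ m * (y + y ^ 2 + y ^ 3 + y ^ 4) := mul_le_mul_of_nonneg_right (card_ipwb_le_three_pow m) (by positivity)
    _ = 3 ^ 28 * (y + y ^ 2 + y ^ 3 + y ^ 4) := by rw [hm]

/-! ### §2  Kesten's identity at order nine: the head sandwich with symbolic diagonal-nine class numbers -/

/-- The exact laws of the head `f₀, f₂, …, f₉` (tree: «EXCESS-LIMIT» … «CENSUS-EIGHT-A»). [cite: MadrasSlade1993, §4.2, (4.2.2) (p. 91)] -/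
private theorem head_laws_ni (y : ℝ) :
    pwbLaw y 0 = 0 ∧ pwbLaw y 2 = 0 ∧ pwbLaw y 3 = y / wallRate y ^ 6 ∧ pwbLaw y 4 = y / wallRate y ^ 8 ∧ pwbLaw y 5 = 3 * y / wallRate y ^ 10 ∧
      pwbLaw y 6 = (6 * y + y ^ 2) / wallRate y ^ 12 ∧ pwbLaw y 7 = (15 * y + 3 * y ^ 2) / wallRate y ^ 14 ∧
      pwbLaw y 8 = (38 * y + 11 * y ^ 2) / wallRate y ^ 16 ∧ pwbLaw y 9 = (98 * y + 34 * y ^ 2 + y ^ 3) / wallRate y ^ 18 := by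
  refine ⟨pwbLaw_zero, ?_, ?_, ?_, ?_, ?_, ?_, ?_, ?_⟩
  · rw [pwbLaw_eq_ni 2 (m := 4) rfl, IPWB_four rfl, zero_div]
  · rw [pwbLaw_eq_ni 3 (m := 6) rfl, IPWB_six rfl]
  · rw [pwbLaw_eq_ni 4 (m := 8) rfl, IPWB_eight_eq rfl]
  · rw [pwbLaw_eq_ni 5 (m := 10) rfl, IPWB_ten_eq rfl]
  · rw [pwbLaw_eq_ni 6 (m := 12) rfl, IPWB_twelve_eq_six rfl]
  · rw [pwbLaw_eq_ni 7 (m := 14) rfl, IPWB_fourteen_eq_fifteen rfl]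
  · rw [pwbLaw_eq_ni 8 (m := 16) rfl, IPWB_sixteen_eq_thirtyEight rfl]
  · rw [pwbLaw_eq_ni 9 (m := 18) rfl, IPWB_eighteen_eq_ninetyEight rfl]

open Classical in
/-- ★ **The head from above** (`y ≥ 0`): `Σ_{k ≤ 14} f_k(y) ≤ H₉(y) + CRUDE₉(y)`, where
`H₉ = y/β² + y/β⁶ + y/β⁸ + 3y/β¹⁰ + (6y + y²)/β¹² + (15y + 3y²)/β¹⁴ + (38y + 11y²)/β¹⁶ + (98y + 34y² + y³)/β¹⁸ + (N₁₀,₁y + 99y² + 7y³)/β²⁰ + (N₁₁,₂y² + 33y³)/β²² +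
(N₁₂,₃y³ + y⁴)/β²⁴ + N₁₃,₄y⁴/β²⁶` (all four diagonal-nine class numbers SYMBOLIC) and
`CRUDE₉ = 3²²y/β²² + 3²⁴(y + y²)/β²⁴ + 3²⁶(y + y² + y³)/β²⁶ + 3²⁸(y + y² + y³ + y⁴)/β²⁸`. [cite: MadrasSlade1993, §4.2, (4.2.2), (4.2.4) (p. 91)] -/
theorem sum_pwbLaw_range_fifteen_le {m₁ m₂ m₃ m₄ : ℕ} (h₁ : m₁ = 20) (h₂ : m₂ = 22) (h₃ : m₃ = 24) (h₄ : m₄ = 26) (hy : 0 ≤ y) :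
    ∑ k ∈ range 15, pwbLaw y k ≤
      (y / wallRate y ^ 2 + y / wallRate y ^ 6 + y / wallRate y ^ 8 + 3 * y / wallRate y ^ 10 +
        (6 * y + y ^ 2) / wallRate y ^ 12 + (15 * y + 3 * y ^ 2) / wallRate y ^ 14 + (38 * y + 11 * y ^ 2) / wallRate y ^ 16 +
        (98 * y + 34 * y ^ 2 + y ^ 3) / wallRate y ^ 18 +
        (#((ipwb m₁).filter fun ω => visits m₁ ω = 1) * y + 99 * y ^ 2 + 7 * y ^ 3) / wallRate y ^ 20 +
        (#((ipwb m₂).filter fun ω => visits m₂ ω = 2) * y ^ 2 + 33 * y ^ 3) / wallRate y ^ 22 +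
        (#((ipwb m₃).filter fun ω => visits m₃ ω = 3) * y ^ 3 + y ^ 4) / wallRate y ^ 24 +
        #((ipwb m₄).filter fun ω => visits m₄ ω = 4) * y ^ 4 / wallRate y ^ 26) +
      (3 ^ 22 * y / wallRate y ^ 22 + 3 ^ 24 * (y + y ^ 2) / wallRate y ^ 24 + 3 ^ 26 * (y + y ^ 2 + y ^ 3) / wallRate y ^ 26 +
          3 ^ 28 * (y + y ^ 2 + y ^ 3 + y ^ 4) / wallRate y ^ 28) := by
  subst h₁ h₂ h₃ h₄
  have hβ := wallRate_pos y
  obtain ⟨e0, e2, e3, e4, e5, e6, e7, e8, e9⟩ := head_laws_ni y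
  have e10 : pwbLaw y 10 = (#((ipwb 20).filter fun ω => visits 20 ω = 1) * y + 99 * y ^ 2 + 7 * y ^ 3) / wallRate y ^ 20 := by
    rw [pwbLaw_eq_ni 10 (m := 20) rfl, IPWB_twenty_eq_ninetyNine rfl]
  have e11 : pwbLaw y 11 ≤ (#((ipwb 22).filter fun ω => visits 22 ω = 2) * y ^ 2 + 33 * y ^ 3) / wallRate y ^ 22 + 3 ^ 22 * y / wallRate y ^ 22 := by
    rw [pwbLaw_eq_ni 11 (m := 22) rfl, ← add_div]
    refine div_le_div_of_nonneg_right ?_ (pow_pos hβ 22).le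
    have h := (IPWB_twentytwo_two_sided (m := 22) rfl hy).2
    linarith
  have e12 : pwbLaw y 12 ≤ (#((ipwb 24).filter fun ω => visits 24 ω = 3) * y ^ 3 + y ^ 4) / wallRate y ^ 24 + 3 ^ 24 * (y + y ^ 2) / wallRate y ^ 24 := by
    rw [pwbLaw_eq_ni 12 (m := 24) rfl, ← add_div]
    refine div_le_div_of_nonneg_right ?_ (pow_pos hβ 24).le
    have h := (IPWB_twentyfour_two_sided (m := 24) rfl hy).2
    linarith
  have e13 : pwbLaw y 13 ≤ #((ipwb 26).filter fun ω => visits 26 ω = 4) * y ^ 4 / wallRate y ^ 26 + 3 ^ 26 * (y + y ^ 2 + y ^ 3) / wallRate y ^ 26 := by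
    rw [pwbLaw_eq_ni 13 (m := 26) rfl, ← add_div]
    refine div_le_div_of_nonneg_right ?_ (pow_pos hβ 26).le
    have h := (IPWB_twentysix_two_sided (m := 26) rfl hy).2
    linarith
  have e14 : pwbLaw y 14 ≤ 3 ^ 28 * (y + y ^ 2 + y ^ 3 + y ^ 4) / wallRate y ^ 28 := by
    rw [pwbLaw_eq_ni 14 (m := 28) rfl]
    exact div_le_div_of_nonneg_right (IPWB_twentyeight_le rfl hy) (pow_pos hβ 28).le
  have e1 := pwbLaw_one_le_div_ni hy
  simp only [Finset.sum_range_succ, Finset.sum_range_zero, e0, e2, e3, e4, e5, e6, e7, e8, e9, e10]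
  linarith

open Classical in
/-- ★ **The head from below** (`y > 0`): `H₉(y) ≤ Σ_{k ≤ 14} f_k(y)` (symbolic class numbers; the one-visit twenty-twos, the `≤ 2`-visit twenty-fours,
the `≤ 3`-visit twenty-sixes and the whole block `k = 14` dropped; `y/β² ≤ f₁`). [cite: MadrasSlade1993, §4.2, (4.2.2), (4.2.4) (p. 91)] -/
theorem head_le_sum_pwbLaw_range_fifteen {m₁ m₂ m₃ m₄ : ℕ} (h₁ : m₁ = 20) (h₂ : m₂ = 22) (h₃ : m₃ = 24) (h₄ : m₄ = 26) (hy : 0 < y) :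
    y / wallRate y ^ 2 + y / wallRate y ^ 6 + y / wallRate y ^ 8 + 3 * y / wallRate y ^ 10 +
        (6 * y + y ^ 2) / wallRate y ^ 12 + (15 * y + 3 * y ^ 2) / wallRate y ^ 14 + (38 * y + 11 * y ^ 2) / wallRate y ^ 16 +
        (98 * y + 34 * y ^ 2 + y ^ 3) / wallRate y ^ 18 +
        (#((ipwb m₁).filter fun ω => visits m₁ ω = 1) * y + 99 * y ^ 2 + 7 * y ^ 3) / wallRate y ^ 20 +
        (#((ipwb m₂).filter fun ω => visits m₂ ω = 2) * y ^ 2 + 33 * y ^ 3) / wallRate y ^ 22 +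
        (#((ipwb m₃).filter fun ω => visits m₃ ω = 3) * y ^ 3 + y ^ 4) / wallRate y ^ 24 +
        #((ipwb m₄).filter fun ω => visits m₄ ω = 4) * y ^ 4 / wallRate y ^ 26 ≤
      ∑ k ∈ range 15, pwbLaw y k := by
  subst h₁ h₂ h₃ h₄
  have hβ := wallRate_pos y
  obtain ⟨e0, e2, e3, e4, e5, e6, e7, e8, e9⟩ := head_laws_ni y
  have e10 : pwbLaw y 10 = (#((ipwb 20).filter fun ω => visits 20 ω = 1) * y + 99 * y ^ 2 + 7 * y ^ 3) / wallRate y ^ 20 := by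
    rw [pwbLaw_eq_ni 10 (m := 20) rfl, IPWB_twenty_eq_ninetyNine rfl]
  have e11 : (#((ipwb 22).filter fun ω => visits 22 ω = 2) * y ^ 2 + 33 * y ^ 3) / wallRate y ^ 22 ≤ pwbLaw y 11 := by
    rw [pwbLaw_eq_ni 11 (m := 22) rfl]
    exact div_le_div_of_nonneg_right (IPWB_twentytwo_two_sided (m := 22) rfl hy.le).1 (pow_pos hβ 22).le
  have e12 : (#((ipwb 24).filter fun ω => visits 24 ω = 3) * y ^ 3 + y ^ 4) / wallRate y ^ 24 ≤ pwbLaw y 12 := by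
    rw [pwbLaw_eq_ni 12 (m := 24) rfl]
    exact div_le_div_of_nonneg_right (IPWB_twentyfour_two_sided (m := 24) rfl hy.le).1 (pow_pos hβ 24).le
  have e13 : #((ipwb 26).filter fun ω => visits 26 ω = 4) * y ^ 4 / wallRate y ^ 26 ≤ pwbLaw y 13 := by
    rw [pwbLaw_eq_ni 13 (m := 26) rfl]
    exact div_le_div_of_nonneg_right (IPWB_twentysix_two_sided (m := 26) rfl hy.le).1 (pow_pos hβ 26).le
  have e14 : 0 ≤ pwbLaw y 14 := pwbLaw_nonneg hy.le 14
  have e1 := div_sq_wallRate_le_pwbLaw_one hy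
  simp only [Finset.sum_range_succ, Finset.sum_range_zero, e0, e2, e3, e4, e5, e6, e7, e8, e9, e10]
  linarith

/-- `Σ_{k ≤ n} f_k(y) ≤ 1` for `y > μ³` (partial sums of Kesten's identity). [cite: MadrasSlade1993, §4.2, (4.2.4), Theorem 4.2.2 (pp. 91–92)] -/
private theorem sum_pwbLaw_range_le_one_ni (hy : hexConnectiveConstant ^ 3 < y) (n : ℕ) :
    ∑ k ∈ range n, pwbLaw y k ≤ 1 := by
  have hμ := hexConnectiveConstant_pos
  have hy0 : 0 < y := lt_of_le_of_lt (by positivity) hy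
  exact sum_le_hasSum (range n) (fun k _ => pwbLaw_nonneg hy0.le k) (hasSum_pwbLaw_of_cube_lt hy)

open Classical in
/-- ★★ **The order-nine head sandwich** for `y > μ³` (symbolic diagonal-nine class numbers):
`1 − Aθ₃^{14} − CRUDE₉(y) ≤ H₉(y) ≤ 1`, `θ₃ = μ²/y^{2/3}`, `A = (μ² + y^{2/3}/μ²)θ₃/(1 − θ₃)` — the tail at `n = 14` is `≍ y^{−28/3} = o(y⁻⁹)` and every
crude term is `O(y⁻¹⁰)`, so the inversion of this inequality in `β²` pins the ninth coefficient.
[cite: MadrasSlade1993, §4.2, (4.2.2), (4.2.4), Theorem 4.2.2 (pp. 91–92)] [cite: Kesten1963SAW, §4] -/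
theorem kesten_head_nine_sandwich_of_cube_lt {m₁ m₂ m₃ m₄ : ℕ} (h₁ : m₁ = 20) (h₂ : m₂ = 22) (h₃ : m₃ = 24) (h₄ : m₄ = 26)
    (hy : hexConnectiveConstant ^ 3 < y) :
    1 - (hexConnectiveConstant ^ 2 + y ^ ((2 : ℝ) / 3) / hexConnectiveConstant ^ 2) *
          (hexConnectiveConstant ^ 2 / y ^ ((2 : ℝ) / 3)) / (1 - hexConnectiveConstant ^ 2 / y ^ ((2 : ℝ) / 3)) *
          (hexConnectiveConstant ^ 2 / y ^ ((2 : ℝ) / 3)) ^ 14 -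
        (3 ^ 22 * y / wallRate y ^ 22 + 3 ^ 24 * (y + y ^ 2) / wallRate y ^ 24 + 3 ^ 26 * (y + y ^ 2 + y ^ 3) / wallRate y ^ 26 +
          3 ^ 28 * (y + y ^ 2 + y ^ 3 + y ^ 4) / wallRate y ^ 28) ≤
      y / wallRate y ^ 2 + y / wallRate y ^ 6 + y / wallRate y ^ 8 + 3 * y / wallRate y ^ 10 +
        (6 * y + y ^ 2) / wallRate y ^ 12 + (15 * y + 3 * y ^ 2) / wallRate y ^ 14 + (38 * y + 11 * y ^ 2) / wallRate y ^ 16 +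
        (98 * y + 34 * y ^ 2 + y ^ 3) / wallRate y ^ 18 +
        (#((ipwb m₁).filter fun ω => visits m₁ ω = 1) * y + 99 * y ^ 2 + 7 * y ^ 3) / wallRate y ^ 20 +
        (#((ipwb m₂).filter fun ω => visits m₂ ω = 2) * y ^ 2 + 33 * y ^ 3) / wallRate y ^ 22 +
        (#((ipwb m₃).filter fun ω => visits m₃ ω = 3) * y ^ 3 + y ^ 4) / wallRate y ^ 24 +
        #((ipwb m₄).filter fun ω => visits m₄ ω = 4) * y ^ 4 / wallRate y ^ 26 ∧
    y / wallRate y ^ 2 + y / wallRate y ^ 6 + y / wallRate y ^ 8 + 3 * y / wallRate y ^ 10 +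
        (6 * y + y ^ 2) / wallRate y ^ 12 + (15 * y + 3 * y ^ 2) / wallRate y ^ 14 + (38 * y + 11 * y ^ 2) / wallRate y ^ 16 +
        (98 * y + 34 * y ^ 2 + y ^ 3) / wallRate y ^ 18 +
        (#((ipwb m₁).filter fun ω => visits m₁ ω = 1) * y + 99 * y ^ 2 + 7 * y ^ 3) / wallRate y ^ 20 +
        (#((ipwb m₂).filter fun ω => visits m₂ ω = 2) * y ^ 2 + 33 * y ^ 3) / wallRate y ^ 22 +
        (#((ipwb m₃).filter fun ω => visits m₃ ω = 3) * y ^ 3 + y ^ 4) / wallRate y ^ 24 +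
        #((ipwb m₄).filter fun ω => visits m₄ ω = 4) * y ^ 4 / wallRate y ^ 26 ≤ 1 := by
  have hμ := hexConnectiveConstant_pos
  have hy0 : 0 < y := lt_of_le_of_lt (by positivity) hy
  have htail := one_sub_sum_pwbLaw_le_of_cube_lt hy 14
  have hup := sum_pwbLaw_range_fifteen_le h₁ h₂ h₃ h₄ hy0.le
  have hlow := head_le_sum_pwbLaw_range_fifteen h₁ h₂ h₃ h₄ hy0
  have hone := sum_pwbLaw_range_le_one_ni hy 15
  constructor
  · linarith
  · linarith

/-! ### §3  The tail is negligible at order nine: `y⁸ β² (Aθ₃^{14} + CRUDE₉) → 0` -/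

/-- ★ The envelope part: `y⁹ · Aθ₃^{14} → 0` (`= μ^{28} · (1 + μ⁴/y^{2/3})/(1 − μ²/y^{2/3}) · y^{−1/3}`). [cite: MadrasSlade1993, Section 4.2, remark before (4.2.21) (p. 94)] -/
theorem tendsto_pow_nine_mul_envelope_tail :
    Tendsto (fun y : ℝ => y ^ 9 *
      ((hexConnectiveConstant ^ 2 + y ^ ((2 : ℝ) / 3) / hexConnectiveConstant ^ 2) *
          (hexConnectiveConstant ^ 2 / y ^ ((2 : ℝ) / 3)) / (1 - hexConnectiveConstant ^ 2 / y ^ ((2 : ℝ) / 3)) *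
          (hexConnectiveConstant ^ 2 / y ^ ((2 : ℝ) / 3)) ^ 14)) atTop (𝓝 0) := by
  have hμ := hexConnectiveConstant_pos
  have hs : Tendsto (fun y : ℝ => y ^ ((2 : ℝ) / 3)) atTop atTop := tendsto_rpow_atTop (by norm_num)
  have hs3 : Tendsto (fun y : ℝ => y ^ ((1 : ℝ) / 3)) atTop atTop := tendsto_rpow_atTop (by norm_num)
  have hc : Tendsto (fun y : ℝ => (y ^ ((1 : ℝ) / 3))⁻¹) atTop (𝓝 0) := hs3.inv_tendsto_atTop
  have hA : Tendsto (fun y : ℝ => (hexConnectiveConstant ^ 4 / y ^ ((2 : ℝ) / 3) + 1) /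
      (1 - hexConnectiveConstant ^ 2 / y ^ ((2 : ℝ) / 3))) atTop (𝓝 ((0 + 1) / (1 - 0))) :=
    ((tendsto_const_nhds.div_atTop hs).add tendsto_const_nhds).div
      (tendsto_const_nhds.sub (tendsto_const_nhds.div_atTop hs)) (by norm_num)
  have h := (hA.const_mul (hexConnectiveConstant ^ 28)).mul hc
  rw [show hexConnectiveConstant ^ 28 * ((0 + 1) / (1 - 0)) * (0 : ℝ) = 0 by ring] at h
  refine h.congr' ?_
  filter_upwards [eventually_gt_atTop (hexConnectiveConstant ^ 3)] with y hy
  have hy0 : 0 < y := lt_of_le_of_lt (by positivity) hy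
  have hs0 : 0 < y ^ ((2 : ℝ) / 3) := Real.rpow_pos_of_pos hy0 _
  have hs30 : 0 < y ^ ((1 : ℝ) / 3) := Real.rpow_pos_of_pos hy0 _
  have hθ := theta_cube_lt_one hy
  have hD : 1 - hexConnectiveConstant ^ 2 / y ^ ((2 : ℝ) / 3) ≠ 0 := by linarith
  have hD' : y ^ ((2 : ℝ) / 3) - hexConnectiveConstant ^ 2 ≠ 0 := by
    intro h0
    apply hD
    rw [sub_eq_zero] at h0
    rw [← h0, div_self hs0.ne', sub_self]
  rw [div_pow, ← pow_mul, show 2 * 14 = 28 by norm_num, rpow_two_thirds_pow_fourteen_ni hy0]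
  field_simp

/-- ★ The crude-count part: `y⁹ · CRUDE₉(y) → 0` (`CRUDE₉ = 3²²y/β²² + 3²⁴(y + y²)/β²⁴ + 3²⁶(y + y² + y³)/β²⁶ + 3²⁸(y + y² + y³ + y⁴)/β²⁸`; with
`r = y/β² → 1` and `u = 1/y` the product is `3²²r¹¹u + 3²⁴r¹²(u² + u) + 3²⁶r¹³(u³ + u² + u) + 3²⁸r¹⁴(u⁴ + u³ + u² + u)`).
[cite: BeatonBousquetMelouDeGierDuminilCopinGuttmann2014, Section 3.1, Proposition 5 (arXiv v5 p. 9)] -/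
theorem tendsto_pow_nine_mul_crude_tail :
    Tendsto (fun y : ℝ => y ^ 9 * (3 ^ 22 * y / wallRate y ^ 22 + 3 ^ 24 * (y + y ^ 2) / wallRate y ^ 24 + 3 ^ 26 * (y + y ^ 2 + y ^ 3) / wallRate y ^ 26 +
          3 ^ 28 * (y + y ^ 2 + y ^ 3 + y ^ 4) / wallRate y ^ 28)) atTop (𝓝 0) := by
  have hr := tendsto_div_sq_wallRate_ni
  have hu : Tendsto (fun y : ℝ => y⁻¹) atTop (𝓝 0) := tendsto_inv_atTop_zero
  have h := (((((hr.pow 11).const_mul ((3 : ℝ) ^ 22)).mul hu).add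
    (((hr.pow 12).const_mul ((3 : ℝ) ^ 24)).mul ((hu.pow 2).add hu))).add
    (((hr.pow 13).const_mul ((3 : ℝ) ^ 26)).mul (((hu.pow 3).add (hu.pow 2)).add hu))).add
    (((hr.pow 14).const_mul ((3 : ℝ) ^ 28)).mul ((((hu.pow 4).add (hu.pow 3)).add (hu.pow 2)).add hu))
  refine Tendsto.congr' ?_ (tendsto_of_tendsto_of_eq_ni h (by norm_num))
  filter_upwards [eventually_gt_atTop (0 : ℝ)] with y hy
  have hB : wallRate y ≠ 0 := (wallRate_pos y).ne'
  have hy' : y ≠ 0 := hy.ne'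
  field_simp

/-- ★★ **The whole tail is negligible at order nine**: `y⁸ β(y)² (Aθ₃^{14} + CRUDE₉(y)) → 0` (`= (β²/y) · y⁹(…)`, `β²/y → 1`).
[cite: MadrasSlade1993, Section 4.2, Theorem 4.2.2 (pp. 91–92)] -/
theorem tendsto_pow_eight_mul_sq_wallRate_mul_tail_nine :
    Tendsto (fun y : ℝ => y ^ 8 * wallRate y ^ 2 *
      ((hexConnectiveConstant ^ 2 + y ^ ((2 : ℝ) / 3) / hexConnectiveConstant ^ 2) *
          (hexConnectiveConstant ^ 2 / y ^ ((2 : ℝ) / 3)) / (1 - hexConnectiveConstant ^ 2 / y ^ ((2 : ℝ) / 3)) *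
          (hexConnectiveConstant ^ 2 / y ^ ((2 : ℝ) / 3)) ^ 14 +
        (3 ^ 22 * y / wallRate y ^ 22 + 3 ^ 24 * (y + y ^ 2) / wallRate y ^ 24 + 3 ^ 26 * (y + y ^ 2 + y ^ 3) / wallRate y ^ 26 +
          3 ^ 28 * (y + y ^ 2 + y ^ 3 + y ^ 4) / wallRate y ^ 28))) atTop (𝓝 0) := by
  have h := tendsto_sq_wallRate_div_ni.mul (tendsto_pow_nine_mul_envelope_tail.add tendsto_pow_nine_mul_crude_tail)
  rw [add_zero, mul_zero] at h
  refine h.congr' ?_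
  filter_upwards [eventually_gt_atTop (0 : ℝ)] with y hy
  have hy' : y ≠ 0 := hy.ne'
  field_simp

/-! ### §4  The two-sided closed form on `y > μ³` -/

set_option maxHeartbeats 400000 in
open Classical in
/-- ★★ **The order-nine two-sided closed form.**  For `y > μ³`, with `r = y/β(y)²`, `T(y) := y⁸(β² − y − 1/y − 1/y² − 2/y³ − 4/y⁴ − 6/y⁵ − 12/y⁶ − 18/y⁷)`
and `G(y, r) := y⁷(r² − 1) + y⁶(r³ − 1) + y⁵(3r⁴ + r⁵ − 2) + y⁴(6r⁵ + 3r⁶ − 4) + y³(15r⁶ + 11r⁷ + r⁸ − 6) + y²(38r⁷ + 34r⁸ + 7r⁹ − 12) +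
y(98r⁸ + 99r⁹ + 33r¹⁰ + r¹¹ − 18) + (N₁₀,₁r⁹ + N₁₁,₂r¹⁰ + N₁₂,₃r¹¹ + N₁₃,₄r¹²)`:
`G(y, r) ≤ T(y) ≤ G(y, r) + y⁸ β² (Aθ₃^{14} + CRUDE₉(y))` — both sides from the exact identity `T − G = y⁸β²(1 − H₉)` and the sandwich of §2.
[cite: Kesten1963SAW, Section 4] [cite: MadrasSlade1993, Section 4.2, (4.2.2), (4.2.4), Theorem 4.2.2 (pp. 91–92)] -/
theorem ninth_order_two_sided_of_cube_lt {m₁ m₂ m₃ m₄ : ℕ} (h₁ : m₁ = 20) (h₂ : m₂ = 22) (h₃ : m₃ = 24) (h₄ : m₄ = 26)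
    (hy : hexConnectiveConstant ^ 3 < y) :
    y ^ 7 * ((y / wallRate y ^ 2) ^ 2 - 1) + y ^ 6 * ((y / wallRate y ^ 2) ^ 3 - 1) +
        y ^ 5 * (3 * (y / wallRate y ^ 2) ^ 4 + (y / wallRate y ^ 2) ^ 5 - 2) +
        y ^ 4 * (6 * (y / wallRate y ^ 2) ^ 5 + 3 * (y / wallRate y ^ 2) ^ 6 - 4) +
        y ^ 3 * (15 * (y / wallRate y ^ 2) ^ 6 + 11 * (y / wallRate y ^ 2) ^ 7 + (y / wallRate y ^ 2) ^ 8 - 6) +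
        y ^ 2 * (38 * (y / wallRate y ^ 2) ^ 7 + 34 * (y / wallRate y ^ 2) ^ 8 + 7 * (y / wallRate y ^ 2) ^ 9 - 12) +
        y * (98 * (y / wallRate y ^ 2) ^ 8 + 99 * (y / wallRate y ^ 2) ^ 9 + 33 * (y / wallRate y ^ 2) ^ 10 + (y / wallRate y ^ 2) ^ 11 - 18) +
        (#((ipwb m₁).filter fun ω => visits m₁ ω = 1) * (y / wallRate y ^ 2) ^ 9 + #((ipwb m₂).filter fun ω => visits m₂ ω = 2) * (y / wallRate y ^ 2) ^ 10 + #((ipwb m₃).filter fun ω => visits m₃ ω = 3) * (y / wallRate y ^ 2) ^ 11 + #((ipwb m₄).filter fun ω => visits m₄ ω = 4) * (y / wallRate y ^ 2) ^ 12) ≤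
      y ^ 8 * (wallRate y ^ 2 - y - 1 / y - 1 / y ^ 2 - 2 / y ^ 3 - 4 / y ^ 4 - 6 / y ^ 5 - 12 / y ^ 6 - 18 / y ^ 7) ∧
    y ^ 8 * (wallRate y ^ 2 - y - 1 / y - 1 / y ^ 2 - 2 / y ^ 3 - 4 / y ^ 4 - 6 / y ^ 5 - 12 / y ^ 6 - 18 / y ^ 7) ≤
      (y ^ 7 * ((y / wallRate y ^ 2) ^ 2 - 1) + y ^ 6 * ((y / wallRate y ^ 2) ^ 3 - 1) +
        y ^ 5 * (3 * (y / wallRate y ^ 2) ^ 4 + (y / wallRate y ^ 2) ^ 5 - 2) +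
        y ^ 4 * (6 * (y / wallRate y ^ 2) ^ 5 + 3 * (y / wallRate y ^ 2) ^ 6 - 4) +
        y ^ 3 * (15 * (y / wallRate y ^ 2) ^ 6 + 11 * (y / wallRate y ^ 2) ^ 7 + (y / wallRate y ^ 2) ^ 8 - 6) +
        y ^ 2 * (38 * (y / wallRate y ^ 2) ^ 7 + 34 * (y / wallRate y ^ 2) ^ 8 + 7 * (y / wallRate y ^ 2) ^ 9 - 12) +
        y * (98 * (y / wallRate y ^ 2) ^ 8 + 99 * (y / wallRate y ^ 2) ^ 9 + 33 * (y / wallRate y ^ 2) ^ 10 + (y / wallRate y ^ 2) ^ 11 - 18) +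
        (#((ipwb m₁).filter fun ω => visits m₁ ω = 1) * (y / wallRate y ^ 2) ^ 9 + #((ipwb m₂).filter fun ω => visits m₂ ω = 2) * (y / wallRate y ^ 2) ^ 10 + #((ipwb m₃).filter fun ω => visits m₃ ω = 3) * (y / wallRate y ^ 2) ^ 11 + #((ipwb m₄).filter fun ω => visits m₄ ω = 4) * (y / wallRate y ^ 2) ^ 12)) +
      y ^ 8 * wallRate y ^ 2 *
        ((hexConnectiveConstant ^ 2 + y ^ ((2 : ℝ) / 3) / hexConnectiveConstant ^ 2) *
          (hexConnectiveConstant ^ 2 / y ^ ((2 : ℝ) / 3)) / (1 - hexConnectiveConstant ^ 2 / y ^ ((2 : ℝ) / 3)) *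
          (hexConnectiveConstant ^ 2 / y ^ ((2 : ℝ) / 3)) ^ 14 +
          (3 ^ 22 * y / wallRate y ^ 22 + 3 ^ 24 * (y + y ^ 2) / wallRate y ^ 24 + 3 ^ 26 * (y + y ^ 2 + y ^ 3) / wallRate y ^ 26 +
          3 ^ 28 * (y + y ^ 2 + y ^ 3 + y ^ 4) / wallRate y ^ 28)) := by
  have hμ := hexConnectiveConstant_pos
  have hy0 : 0 < y := lt_of_le_of_lt (by positivity) hy
  have hβ := wallRate_pos y
  have hB : wallRate y ≠ 0 := hβ.ne'
  obtain ⟨hlow, hone⟩ := kesten_head_nine_sandwich_of_cube_lt h₁ h₂ h₃ h₄ hy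
  set N₁ := (#((ipwb m₁).filter fun ω => visits m₁ ω = 1) : ℝ) with hN₁
  set N₂ := (#((ipwb m₂).filter fun ω => visits m₂ ω = 2) : ℝ) with hN₂
  set N₃ := (#((ipwb m₃).filter fun ω => visits m₃ ω = 3) : ℝ) with hN₃
  set N₄ := (#((ipwb m₄).filter fun ω => visits m₄ ω = 4) : ℝ) with hN₄
  set a := (hexConnectiveConstant ^ 2 + y ^ ((2 : ℝ) / 3) / hexConnectiveConstant ^ 2) *
          (hexConnectiveConstant ^ 2 / y ^ ((2 : ℝ) / 3)) / (1 - hexConnectiveConstant ^ 2 / y ^ ((2 : ℝ) / 3)) *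
          (hexConnectiveConstant ^ 2 / y ^ ((2 : ℝ) / 3)) ^ 14 with ha
  set b := 3 ^ 22 * y / wallRate y ^ 22 + 3 ^ 24 * (y + y ^ 2) / wallRate y ^ 24 + 3 ^ 26 * (y + y ^ 2 + y ^ 3) / wallRate y ^ 26 +
          3 ^ 28 * (y + y ^ 2 + y ^ 3 + y ^ 4) / wallRate y ^ 28 with hb
  set K := y / wallRate y ^ 2 + y / wallRate y ^ 6 + y / wallRate y ^ 8 + 3 * y / wallRate y ^ 10 +
      (6 * y + y ^ 2) / wallRate y ^ 12 + (15 * y + 3 * y ^ 2) / wallRate y ^ 14 + (38 * y + 11 * y ^ 2) / wallRate y ^ 16 +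
      (98 * y + 34 * y ^ 2 + y ^ 3) / wallRate y ^ 18 + (N₁ * y + 99 * y ^ 2 + 7 * y ^ 3) / wallRate y ^ 20 +
      (N₂ * y ^ 2 + 33 * y ^ 3) / wallRate y ^ 22 + (N₃ * y ^ 3 + y ^ 4) / wallRate y ^ 24 + N₄ * y ^ 4 / wallRate y ^ 26 with hK
  have key : y ^ 8 * (wallRate y ^ 2 - y - 1 / y - 1 / y ^ 2 - 2 / y ^ 3 - 4 / y ^ 4 - 6 / y ^ 5 - 12 / y ^ 6 - 18 / y ^ 7) -
      (y ^ 7 * ((y / wallRate y ^ 2) ^ 2 - 1) + y ^ 6 * ((y / wallRate y ^ 2) ^ 3 - 1) +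
        y ^ 5 * (3 * (y / wallRate y ^ 2) ^ 4 + (y / wallRate y ^ 2) ^ 5 - 2) +
        y ^ 4 * (6 * (y / wallRate y ^ 2) ^ 5 + 3 * (y / wallRate y ^ 2) ^ 6 - 4) +
        y ^ 3 * (15 * (y / wallRate y ^ 2) ^ 6 + 11 * (y / wallRate y ^ 2) ^ 7 + (y / wallRate y ^ 2) ^ 8 - 6) +
        y ^ 2 * (38 * (y / wallRate y ^ 2) ^ 7 + 34 * (y / wallRate y ^ 2) ^ 8 + 7 * (y / wallRate y ^ 2) ^ 9 - 12) +
        y * (98 * (y / wallRate y ^ 2) ^ 8 + 99 * (y / wallRate y ^ 2) ^ 9 + 33 * (y / wallRate y ^ 2) ^ 10 + (y / wallRate y ^ 2) ^ 11 - 18) +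
        (N₁ * (y / wallRate y ^ 2) ^ 9 + N₂ * (y / wallRate y ^ 2) ^ 10 + N₃ * (y / wallRate y ^ 2) ^ 11 + N₄ * (y / wallRate y ^ 2) ^ 12)) =
      y ^ 8 * wallRate y ^ 2 * (1 - K) := by
    rw [hK]
    field_simp
    ring
  have hpos : 0 ≤ y ^ 8 * wallRate y ^ 2 := by positivity
  have h0 : 0 ≤ y ^ 8 * wallRate y ^ 2 * (1 - K) := mul_nonneg hpos (sub_nonneg.2 hone)
  have h1 : 1 - K ≤ a + b := by linarith
  have h2 : y ^ 8 * wallRate y ^ 2 * (1 - K) ≤ y ^ 8 * wallRate y ^ 2 * (a + b) := mul_le_mul_of_nonneg_left h1 hpos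
  constructor
  · linarith
  · linarith

/-! ### §5  The limit of the comparison function: `G(y, r) → N₁₀,₁ + N₁₁,₂ + N₁₂,₃ + N₁₃,₄ − 695` -/

open Classical in
/-- ★★ **The comparison function tends to the diagonal-nine census minus 695**: its numeric part is an exact polynomial in the `β²`-tower
`A, Q, P, H, K, L` and `u = 1/y` (44 monomials, `ring`) tending to `−695` (orders one to seven EXACT), and `N r^s → N`.
[cite: BeatonBousquetMelouDeGierDuminilCopinGuttmann2014, Section 3.1, Proposition 5 (arXiv v5 p. 9)] [cite: MadrasSlade1993, Section 4.2, (4.2.4) (p. 91)] -/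
theorem tendsto_ninth_order_comparison (m₁ m₂ m₃ m₄ : ℕ) :
    Tendsto (fun y : ℝ => y ^ 7 * ((y / wallRate y ^ 2) ^ 2 - 1) + y ^ 6 * ((y / wallRate y ^ 2) ^ 3 - 1) +
        y ^ 5 * (3 * (y / wallRate y ^ 2) ^ 4 + (y / wallRate y ^ 2) ^ 5 - 2) +
        y ^ 4 * (6 * (y / wallRate y ^ 2) ^ 5 + 3 * (y / wallRate y ^ 2) ^ 6 - 4) +
        y ^ 3 * (15 * (y / wallRate y ^ 2) ^ 6 + 11 * (y / wallRate y ^ 2) ^ 7 + (y / wallRate y ^ 2) ^ 8 - 6) +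
        y ^ 2 * (38 * (y / wallRate y ^ 2) ^ 7 + 34 * (y / wallRate y ^ 2) ^ 8 + 7 * (y / wallRate y ^ 2) ^ 9 - 12) +
        y * (98 * (y / wallRate y ^ 2) ^ 8 + 99 * (y / wallRate y ^ 2) ^ 9 + 33 * (y / wallRate y ^ 2) ^ 10 + (y / wallRate y ^ 2) ^ 11 - 18) +
        (#((ipwb m₁).filter fun ω => visits m₁ ω = 1) * (y / wallRate y ^ 2) ^ 9 + #((ipwb m₂).filter fun ω => visits m₂ ω = 2) * (y / wallRate y ^ 2) ^ 10 + #((ipwb m₃).filter fun ω => visits m₃ ω = 3) * (y / wallRate y ^ 2) ^ 11 + #((ipwb m₄).filter fun ω => visits m₄ ω = 4) * (y / wallRate y ^ 2) ^ 12))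
      atTop (𝓝 ((#((ipwb m₁).filter fun ω => visits m₁ ω = 1) : ℝ) + #((ipwb m₂).filter fun ω => visits m₂ ω = 2) +
        #((ipwb m₃).filter fun ω => visits m₃ ω = 3) + #((ipwb m₄).filter fun ω => visits m₄ ω = 4) - 695)) := by
  set N₁ := (#((ipwb m₁).filter fun ω => visits m₁ ω = 1) : ℝ) with hN₁
  set N₂ := (#((ipwb m₂).filter fun ω => visits m₂ ω = 2) : ℝ) with hN₂
  set N₃ := (#((ipwb m₃).filter fun ω => visits m₃ ω = 3) : ℝ) with hN₃
  set N₄ := (#((ipwb m₄).filter fun ω => visits m₄ ω = 4) : ℝ) with hN₄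
  have hr := tendsto_div_sq_wallRate_ni
  have hA := tendsto_sq_mul_one_sub_div_wallRate_sq
  have hQ := tendsto_cube_mul_one_sub_div_sub
  have hP := tendsto_pow_four_mul_one_sub_div_sub
  have hH := tendsto_pow_five_mul_one_sub_div_sub
  have hK := tendsto_pow_six_mul_one_sub_div_sub
  have hL := tendsto_pow_seven_mul_one_sub_div_sub
  have hu : Tendsto (fun y : ℝ => y⁻¹) atTop (𝓝 0) := tendsto_inv_atTop_zero
  have hN := ((((hr.pow 9).const_mul N₁).add ((hr.pow 10).const_mul N₂)).add ((hr.pow 11).const_mul N₃)).add ((hr.pow 12).const_mul N₄)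
  have h0 := (((((((((((((((((((((((((((((((((((((((((((((hA.pow 3).const_mul ((-1) : ℝ)).add
      ((hA.pow 2).const_mul (105 : ℝ))).add
      ((hA.mul hQ).const_mul (28 : ℝ))).add
      (hA.const_mul ((-601) : ℝ))).add
      ((hQ.pow 2).const_mul (3 : ℝ))).add
      (hQ.mul hP)).add
      (hQ.const_mul ((-147) : ℝ))).add
      (hP.const_mul ((-41) : ℝ))).add
      (hH.const_mul ((-15) : ℝ))).add
      (hK.const_mul ((-3) : ℝ))).add
      (hL.const_mul ((-2) : ℝ))).add
      (((hA.pow 3).mul hu).const_mul ((-22) : ℝ))).add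
      (((hA.pow 2).mul hu).const_mul (484 : ℝ))).add
      ((hA.mul hu).const_mul ((-2016) : ℝ))).add
      (((hA.pow 3).mul (hu.pow 2)).const_mul ((-120) : ℝ))).add
      (((hA.pow 2).mul (hu.pow 2)).const_mul (2002 : ℝ))).add
      (((hA.pow 4).mul (hu.pow 3)).const_mul (8 : ℝ))).add
      (((hA.pow 3).mul (hu.pow 3)).const_mul ((-741) : ℝ))).add
      (((hA.pow 2).mul (hu.pow 3)).const_mul (7848 : ℝ))).add
      (((hA.pow 4).mul (hu.pow 4)).const_mul (75 : ℝ))).add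
      (((hA.pow 3).mul (hu.pow 4)).const_mul ((-3822) : ℝ))).add
      (((hA.pow 5).mul (hu.pow 5)).const_mul ((-1) : ℝ))).add
      (((hA.pow 4).mul (hu.pow 5)).const_mul (680 : ℝ))).add
      (((hA.pow 3).mul (hu.pow 5)).const_mul ((-17929) : ℝ))).add
      (((hA.pow 5).mul (hu.pow 6)).const_mul ((-24) : ℝ))).add
      (((hA.pow 4).mul (hu.pow 6)).const_mul (4592 : ℝ))).add
      (((hA.pow 5).mul (hu.pow 7)).const_mul ((-377) : ℝ))).add
      (((hA.pow 4).mul (hu.pow 7)).const_mul (26594 : ℝ))).add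
      (((hA.pow 6).mul (hu.pow 8)).const_mul (3 : ℝ))).add
      (((hA.pow 5).mul (hu.pow 8)).const_mul ((-3584) : ℝ))).add
      (((hA.pow 6).mul (hu.pow 9)).const_mul (120 : ℝ))).add
      (((hA.pow 5).mul (hu.pow 9)).const_mul ((-26740) : ℝ))).add
      (((hA.pow 6).mul (hu.pow 10)).const_mul (1806 : ℝ))).add
      (((hA.pow 7).mul (hu.pow 11)).const_mul ((-19) : ℝ))).add
      (((hA.pow 6).mul (hu.pow 11)).const_mul (18452 : ℝ))).add
      (((hA.pow 7).mul (hu.pow 12)).const_mul ((-562) : ℝ))).add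
      ((hA.pow 8).mul (hu.pow 13))).add
      (((hA.pow 7).mul (hu.pow 13)).const_mul ((-8638) : ℝ))).add
      (((hA.pow 8).mul (hu.pow 14)).const_mul (97 : ℝ))).add
      (((hA.pow 8).mul (hu.pow 15)).const_mul (2639 : ℝ))).add
      (((hA.pow 9).mul (hu.pow 16)).const_mul ((-7) : ℝ))).add
      (((hA.pow 9).mul (hu.pow 17)).const_mul ((-484) : ℝ))).add
      (((hA.pow 10).mul (hu.pow 19)).const_mul (44 : ℝ))).add
      (((hA.pow 11).mul (hu.pow 21)).const_mul ((-1) : ℝ)))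
  have h := h0.add hN
  refine Tendsto.congr' ?_ (tendsto_of_tendsto_of_eq_ni h (by ring))
  filter_upwards [eventually_gt_atTop (0 : ℝ)] with y hy
  have hw : wallRate y ≠ 0 := (wallRate_pos y).ne'
  have hy' : y ≠ 0 := hy.ne'
  field_simp
  ring

/-! ### §6  THE NINTH COEFFICIENT IS THE DIAGONAL-NINE CENSUS MINUS 695 -/

open Classical in
/-- ★★★ **THE NINTH-ORDER CENSUS IDENTITY.**  As `y → ∞`,
`y⁸ (β(y)² − y − 1/y − 1/y² − 2/y³ − 4/y⁴ − 6/y⁵ − 12/y⁶ − 18/y⁷) → N₁₀,₁ + N₁₁,₂ + N₁₂,₃ + N₁₃,₄ − 695`,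
where `N_{s,v} = #{ω ∈ ipwb (2s) : visits = v}` are the four class numbers of the diagonal `s − v = 9` of the wall-renewal census (symbolic lengths
`m₁ = 20, …, m₄ = 26`): the ninth coefficient of the strong-adsorption expansion of `β²` EXISTS and is an explicit affine function of the census —
the lower half from Kesten's identity over the exactly counted diagonal `s − v ≤ 8` (cars 63–72, «CENSUS-EIGHT-A/B», «SIX-STEP-RIGIDITY») plus the four
symbolic classes, the upper half from the order-nine head sandwich (six-step tail at `n = 14`, crude counts `3ⁿ` on the classes with `s − v ≥ 10`).  With
the kernel censuses `267 / 295 / 132 / 16` it becomes `a₈ = 15`.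
[cite: Kesten1963SAW, Section 4] [cite: MadrasSlade1993, Section 4.2, (4.2.4), Theorem 4.2.2 (pp. 91–92)] [cite: BeatonBousquetMelouDeGierDuminilCopinGuttmann2014, Section 3.1, Proposition 5 (arXiv v5 p. 9); p. 10] -/
theorem tendsto_pow_eight_mul_wallRate_sq_sub_census {m₁ m₂ m₃ m₄ : ℕ} (h₁ : m₁ = 20) (h₂ : m₂ = 22) (h₃ : m₃ = 24) (h₄ : m₄ = 26) :
    Tendsto (fun y : ℝ => y ^ 8 * (wallRate y ^ 2 - y - 1 / y - 1 / y ^ 2 - 2 / y ^ 3 - 4 / y ^ 4 - 6 / y ^ 5 - 12 / y ^ 6 - 18 / y ^ 7)) atTop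
      (𝓝 ((#((ipwb m₁).filter fun ω => visits m₁ ω = 1) : ℝ) + #((ipwb m₂).filter fun ω => visits m₂ ω = 2) +
        #((ipwb m₃).filter fun ω => visits m₃ ω = 3) + #((ipwb m₄).filter fun ω => visits m₄ ω = 4) - 695)) := by
  have hlo := tendsto_ninth_order_comparison m₁ m₂ m₃ m₄
  have hup := hlo.add tendsto_pow_eight_mul_sq_wallRate_mul_tail_nine
  rw [add_zero] at hup
  refine tendsto_of_tendsto_of_tendsto_of_le_of_le' hlo hup ?_ ?_
  · filter_upwards [eventually_gt_atTop (hexConnectiveConstant ^ 3)] with y hy using (ninth_order_two_sided_of_cube_lt h₁ h₂ h₃ h₄ hy).1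
  · filter_upwards [eventually_gt_atTop (hexConnectiveConstant ^ 3)] with y hy using (ninth_order_two_sided_of_cube_lt h₁ h₂ h₃ h₄ hy).2

open Classical in
/-- ★★ Uniqueness form: any limit of `y⁸(β(y)² − y − … − 18/y⁷)` IS the census expression. [cite: MadrasSlade1993, Section 4.2, Theorem 4.2.2 (pp. 91–92)] -/
theorem eq_census_of_tendsto_pow_eight_mul_wallRate_sq_sub {m₁ m₂ m₃ m₄ : ℕ} (h₁ : m₁ = 20) (h₂ : m₂ = 22) (h₃ : m₃ = 24) (h₄ : m₄ = 26)
    {L : ℝ} (h : Tendsto (fun y : ℝ => y ^ 8 * (wallRate y ^ 2 - y - 1 / y - 1 / y ^ 2 - 2 / y ^ 3 - 4 / y ^ 4 - 6 / y ^ 5 - 12 / y ^ 6 - 18 / y ^ 7)) atTop (𝓝 L)) :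
    L = ((#((ipwb m₁).filter fun ω => visits m₁ ω = 1) : ℝ) + #((ipwb m₂).filter fun ω => visits m₂ ω = 2) +
        #((ipwb m₃).filter fun ω => visits m₃ ω = 3) + #((ipwb m₄).filter fun ω => visits m₄ ω = 4) - 695) :=
  tendsto_nhds_unique h (tendsto_pow_eight_mul_wallRate_sq_sub_census h₁ h₂ h₃ h₄)

end Literature.Probability.RandomPlanarGeometry.SAW.HexBW.Wall

end
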